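import Mathlib
import Summits.ResolutionOfSingularities.ResolutionOfSingularities.Theorems.WeightedInvariantLocalWeightedDropPolyDescentNewton

/-!
# `WeightedInvariant.LocalWeightedDrop`, stub S3ρ: the monic polyhedron descent — the `u₂`-chart and the two curve blow-ups CARRY vertex coefficients, solvability, well-preparedness (piece ρ-N, part 2)

Crux item stmt-ResolutionOfSingularities-8899 `LocalWeightedDrop` (route `ResolutionOfSingularities/WeightedInvariant`), registered skeleton v30
(09f812eb3be8b7d8), stub S3ρ `stub_wildMonicSurfaceReductionWon`.  [OURS · L1 W4.3, chain w43, lead prover (gen 3); a LINE UNDER THE STUB: the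
monic polyhedron descent (second key to S3ρ, memo `L/res-L1-w43-lead-1/g3/S3RHO-CJS-MEMO.md`), MODEL Cossart–Jannsen–Saito LNM 2270 Ch. 8/11–13 for
`J = (y^d + Σ_{j<d} A_j y^j)`, `e = 2`, `k = k̄`; nothing here is a statement of any manuscript.]

* `vertexCoeff_blowTwoT`, `solvable_blowTwoT_iff`, `wellPrepared_blowTwoT` (CJS Lemma 12.2); `vertexCoeff_divOneT/divTwoT`, `solvable_divOneT_iff/…`,
  `wellPrepared_divOneT/divTwoT` (CJS Lemma 12.4): the slotwise monomial maps carry the coefficient of every slot at every scaled point, so the vertex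
  polynomials — and with them the solvability of integral vertices — are transported verbatim.
-/

set_option linter.dupNamespace false -- mandated namespace of this single-conjunct summit

noncomputable section

namespace Summit.ResolutionOfSingularities.ResolutionOfSingularities.Theorems

namespace PolyDescent

open MvPowerSeries MonicDescent WildMonic Literature.RingTheory.TwoVariableSeries

variable {k : Type} [Field k]

/-! ## The `u₂`-chart and the two curve blow-ups: vertex coefficients, solvability, well-preparedness -/

/-- Slot divisibility of `phiE d! P` (order `≥ d!`). -/
theorem forall_slotWeight_dvd_phiE_iff {d : ℕ} (j : Fin d) {P : Fin 2 →₀ ℕ} (hP : d.factorial ≤ P 0 + P 1) :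
    (∀ i, slotWeight d j ∣ phiE d.factorial P i) ↔ ∀ i, slotWeight d j ∣ P i := by
  have hw := slotWeight_dvd_factorial j
  constructor
  · intro h i
    have h0 := h 0; have h1 := h 1
    rw [phiE_apply_zero] at h0; rw [phiE_apply_one] at h1
    fin_cases i
    · exact h0
    · have : P 1 = (P 0 + P 1 - d.factorial) + d.factorial - P 0 := by omega
      show slotWeight d j ∣ P 1
      rw [this]; exact Nat.dvd_sub (Nat.dvd_add h1 hw) h0
  · intro h i
    fin_cases i
    · show slotWeight d j ∣ phiE d.factorial P 0
      rw [phiE_apply_zero]; exact h 0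
    · show slotWeight d j ∣ phiE d.factorial P 1
      rw [phiE_apply_one]; exact Nat.dvd_sub (Nat.dvd_add (h 0) (h 1)) hw

/-- A slot exponent recovered from an integral-for-the-slot scaled point has `e₀ + e₁ ≥ d − j` when `P₀ + P₁ ≥ d!`. -/
theorem sub_le_div_add_div {d : ℕ} (j : Fin d) {P : Fin 2 →₀ ℕ} (hdvd : ∀ i, slotWeight d j ∣ P i) (hP : d.factorial ≤ P 0 + P 1) :
    d - (j : ℕ) ≤ P 0 / slotWeight d j + P 1 / slotWeight d j := by
  have hw := slotWeight_pos j
  have h0 := Nat.div_mul_cancel (hdvd 0)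
  have h1 := Nat.div_mul_cancel (hdvd 1)
  have hws := slotWeight_mul_sub j
  by_contra hlt
  push Not at hlt
  have : (P 0 / slotWeight d j + P 1 / slotWeight d j + 1) * slotWeight d j ≤ (d - (j : ℕ)) * slotWeight d j :=
    Nat.mul_le_mul_right _ hlt
  rw [Nat.add_mul, Nat.add_mul, h0, h1, one_mul, mul_comm (d - (j : ℕ)), hws] at this
  omega

/-- VERTEX COEFFICIENTS UNDER THE `u₂`-CHART. -/
theorem vertexCoeff_blowTwoT {d : ℕ} (A : Fin d → MvPowerSeries (Fin 2) k) {P : Fin 2 →₀ ℕ} (hP : d.factorial ≤ P 0 + P 1) (j : Fin d) :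
    vertexCoeff d (blowTwoT d A) (phiE d.factorial P) j = vertexCoeff d A P j := by
  by_cases hdvd : ∀ i, slotWeight d j ∣ P i
  · have hdvd' := (forall_slotWeight_dvd_phiE_iff j hP).mpr hdvd
    rw [vertexCoeff_of_dvd _ hdvd', vertexCoeff_of_dvd _ hdvd]
    have hw := slotWeight_pos j
    set e : Fin 2 →₀ ℕ := Finsupp.single 0 (P 0 / slotWeight d j) + Finsupp.single 1 (P 1 / slotWeight d j) with he
    have he0 : e 0 = P 0 / slotWeight d j := by simp [he]
    have he1 : e 1 = P 1 / slotWeight d j := by simp [he]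
    have hsum : d - (j : ℕ) ≤ e 0 + e 1 := by rw [he0, he1]; exact sub_le_div_add_div j hdvd hP
    have hidx : (Finsupp.single 0 (phiE d.factorial P 0 / slotWeight d j) + Finsupp.single 1 (phiE d.factorial P 1 / slotWeight d j) :
        Fin 2 →₀ ℕ) = phiE (d - (j : ℕ)) e := by
      refine finsupp_fin2_ext ?_ ?_
      · simp only [Finsupp.add_apply, Finsupp.single_apply, phiE_apply_zero, he0]
        simp
      · simp only [Finsupp.add_apply, Finsupp.single_apply, phiE_apply_one, he0, he1]
        simp
        have h0 := Nat.div_mul_cancel (hdvd 0)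
        have h1 := Nat.div_mul_cancel (hdvd 1)
        have hws := slotWeight_mul_sub j
        apply Nat.eq_of_mul_eq_mul_right hw
        rw [Nat.div_mul_cancel (Nat.dvd_sub (Nat.dvd_add (hdvd 0) (hdvd 1)) (slotWeight_dvd_factorial j)),
          Nat.sub_mul, Nat.add_mul, h0, h1, mul_comm (d - (j : ℕ)), hws]
    rw [hidx]
    exact coeff_blowTwo_phiE _ _ _ hsum
  · rw [vertexCoeff_of_not_dvd _ (fun h => hdvd ((forall_slotWeight_dvd_phiE_iff j hP).mp h)), vertexCoeff_of_not_dvd _ hdvd]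

/-- SOLVABILITY IS CARRIED by the `u₂`-chart. -/
theorem solvable_blowTwoT_iff {d : ℕ} (A : Fin d → MvPowerSeries (Fin 2) k) {P : Fin 2 →₀ ℕ} (hP : d.factorial ≤ P 0 + P 1) :
    Solvable d (blowTwoT d A) (phiE d.factorial P) ↔ Solvable d A P := by
  unfold Solvable IsIntegral
  rw [PureDescent.forall_dvd_phiE_iff d.factorial hP]
  simp only [vertexCoeff_blowTwoT A hP]

/-- WELL-PREPAREDNESS PERSISTS under the `u₂`-chart. -/
theorem wellPrepared_blowTwoT {d : ℕ} (A : Fin d → MvPowerSeries (Fin 2) k) (hA : IsPosT d A) (hWP : WellPrepared d A) :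
    WellPrepared d (blowTwoT d A) := by
  intro Q hQ
  have hQmem : Q ∈ newtonSet (blowTwoT d A) := hQ.1
  rw [newtonSet_blowTwoT A hA] at hQmem hQ
  obtain ⟨P, hP, rfl⟩ := hQmem
  have hsum := factorial_le_sum_of_isPosT hA
  have hv : IsVertex (newtonSet A) P := isVertex_of_isVertex_image_phiEC hsum hP hQ
  rw [solvable_blowTwoT_iff A (hsum P hP)]
  exact hWP P hv

/-- VERTEX COEFFICIENTS UNDER `V(y,u₁)`: the shift by `(d!,0)` carries them (permissible label). -/
theorem vertexCoeff_divOneT {d : ℕ} (A : Fin d → MvPowerSeries (Fin 2) k) {P : Fin 2 →₀ ℕ} (hP : d.factorial ≤ P 0) (j : Fin d) :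
    vertexCoeff d (divOneT d A) (Finsupp.single 0 (P 0 - d.factorial) + Finsupp.single 1 (P 1)) j = vertexCoeff d A P j := by
  have hw := slotWeight_dvd_factorial j
  have hwpos := slotWeight_pos j
  have hiff : (∀ i, slotWeight d j ∣ (Finsupp.single 0 (P 0 - d.factorial) + Finsupp.single 1 (P 1) : Fin 2 →₀ ℕ) i) ↔
      ∀ i, slotWeight d j ∣ P i := by
    constructor
    · intro h i
      have h0 := h 0; have h1 := h 1
      rw [pt_apply_zero] at h0; rw [pt_apply_one] at h1
      fin_cases i
      · have : P 0 = (P 0 - d.factorial) + d.factorial := by omega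
        show slotWeight d j ∣ P 0
        rw [this]; exact Nat.dvd_add h0 hw
      · exact h1
    · intro h i
      fin_cases i
      · show slotWeight d j ∣ (Finsupp.single 0 (P 0 - d.factorial) + Finsupp.single 1 (P 1) : Fin 2 →₀ ℕ) 0
        rw [pt_apply_zero]; exact Nat.dvd_sub (h 0) hw
      · show slotWeight d j ∣ (Finsupp.single 0 (P 0 - d.factorial) + Finsupp.single 1 (P 1) : Fin 2 →₀ ℕ) 1
        rw [pt_apply_one]; exact h 1
  by_cases hdvd : ∀ i, slotWeight d j ∣ P i
  · rw [vertexCoeff_of_dvd _ (hiff.mpr hdvd), vertexCoeff_of_dvd _ hdvd, pt_apply_zero, pt_apply_one]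
    show coeff _ (divOne (d - (j : ℕ)) (A j)) = _
    have hle : d - (j : ℕ) ≤ P 0 / slotWeight d j := by
      have h0 := Nat.div_mul_cancel (hdvd 0)
      have hws := slotWeight_mul_sub j
      by_contra hlt
      push Not at hlt
      have : (P 0 / slotWeight d j + 1) * slotWeight d j ≤ (d - (j : ℕ)) * slotWeight d j := Nat.mul_le_mul_right _ hlt
      rw [Nat.add_mul, h0, one_mul, mul_comm (d - (j : ℕ)), hws] at this
      omega
    have hidx : (Finsupp.single 0 ((P 0 - d.factorial) / slotWeight d j) + Finsupp.single 1 (P 1 / slotWeight d j) : Fin 2 →₀ ℕ) =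
        Finsupp.single 0 ((Finsupp.single 0 (P 0 / slotWeight d j) + Finsupp.single 1 (P 1 / slotWeight d j) : Fin 2 →₀ ℕ) 0 - (d - (j : ℕ))) +
          Finsupp.single 1 ((Finsupp.single 0 (P 0 / slotWeight d j) + Finsupp.single 1 (P 1 / slotWeight d j) : Fin 2 →₀ ℕ) 1) := by
      rw [pt_apply_zero, pt_apply_one]
      congr 2
      apply Nat.eq_of_mul_eq_mul_right hwpos
      rw [Nat.div_mul_cancel (Nat.dvd_sub (hdvd 0) hw), Nat.sub_mul, Nat.div_mul_cancel (hdvd 0), mul_comm (d - (j : ℕ)),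
        slotWeight_mul_sub]
    rw [hidx, coeff_divOne_shift _ _ _ (by rw [pt_apply_zero]; exact hle)]
  · rw [vertexCoeff_of_not_dvd _ (fun h => hdvd (hiff.mp h)), vertexCoeff_of_not_dvd _ hdvd]

/-- SOLVABILITY IS CARRIED by `V(y,u₁)`. -/
theorem solvable_divOneT_iff {d : ℕ} (A : Fin d → MvPowerSeries (Fin 2) k) {P : Fin 2 →₀ ℕ} (hP : d.factorial ≤ P 0) :
    Solvable d (divOneT d A) (Finsupp.single 0 (P 0 - d.factorial) + Finsupp.single 1 (P 1)) ↔ Solvable d A P := by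
  unfold Solvable IsIntegral
  have hI : (∀ i, d.factorial ∣ (Finsupp.single 0 (P 0 - d.factorial) + Finsupp.single 1 (P 1) : Fin 2 →₀ ℕ) i) ↔ ∀ i, d.factorial ∣ P i := by
    constructor
    · intro h i
      have h0 := h 0; have h1 := h 1
      rw [pt_apply_zero] at h0; rw [pt_apply_one] at h1
      fin_cases i
      · have : P 0 = (P 0 - d.factorial) + d.factorial := by omega
        show d.factorial ∣ P 0
        rw [this]; exact Nat.dvd_add h0 (dvd_refl _)
      · exact h1
    · intro h i
      fin_cases i
      · show d.factorial ∣ (Finsupp.single 0 (P 0 - d.factorial) + Finsupp.single 1 (P 1) : Fin 2 →₀ ℕ) 0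
        rw [pt_apply_zero]; exact Nat.dvd_sub (h 0) (dvd_refl _)
      · show d.factorial ∣ (Finsupp.single 0 (P 0 - d.factorial) + Finsupp.single 1 (P 1) : Fin 2 →₀ ℕ) 1
        rw [pt_apply_one]; exact h 1
  rw [hI]
  simp only [vertexCoeff_divOneT A hP]

/-- WELL-PREPAREDNESS PERSISTS under `V(y,u₁)` (CJS Lemma 12.4). -/
theorem wellPrepared_divOneT {d : ℕ} (A : Fin d → MvPowerSeries (Fin 2) k) (hA : IsPermissibleOneT d A) (hWP : WellPrepared d A) :
    WellPrepared d (divOneT d A) := by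
  intro Q hQ
  have hQmem : Q ∈ newtonSet (divOneT d A) := hQ.1
  rw [newtonSet_divOneT A hA] at hQmem hQ
  obtain ⟨P, hP, rfl⟩ := hQmem
  have hv : IsVertex (newtonSet A) P := (isVertex_image_shift_iff (shiftOneF_fst hA) (shiftOneF_snd d A) hP).mp hQ
  have hP0 : d.factorial ≤ P 0 := by have := shiftOneF_fst hA P hP; omega
  rw [solvable_divOneT_iff A hP0]
  exact hWP P hv

/-- VERTEX COEFFICIENTS UNDER `V(y,u₂)`: the shift by `(0,d!)` carries them (permissible label). -/
theorem vertexCoeff_divTwoT {d : ℕ} (A : Fin d → MvPowerSeries (Fin 2) k) {P : Fin 2 →₀ ℕ} (hP : d.factorial ≤ P 1) (j : Fin d) :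
    vertexCoeff d (divTwoT d A) (Finsupp.single 0 (P 0) + Finsupp.single 1 (P 1 - d.factorial)) j = vertexCoeff d A P j := by
  have hw := slotWeight_dvd_factorial j
  have hwpos := slotWeight_pos j
  have hiff : (∀ i, slotWeight d j ∣ (Finsupp.single 0 (P 0) + Finsupp.single 1 (P 1 - d.factorial) : Fin 2 →₀ ℕ) i) ↔
      ∀ i, slotWeight d j ∣ P i := by
    constructor
    · intro h i
      have h0 := h 0; have h1 := h 1
      rw [pt_apply_zero] at h0; rw [pt_apply_one] at h1
      fin_cases i
      · exact h0
      · have : P 1 = (P 1 - d.factorial) + d.factorial := by omega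
        show slotWeight d j ∣ P 1
        rw [this]; exact Nat.dvd_add h1 hw
    · intro h i
      fin_cases i
      · show slotWeight d j ∣ (Finsupp.single 0 (P 0) + Finsupp.single 1 (P 1 - d.factorial) : Fin 2 →₀ ℕ) 0
        rw [pt_apply_zero]; exact h 0
      · show slotWeight d j ∣ (Finsupp.single 0 (P 0) + Finsupp.single 1 (P 1 - d.factorial) : Fin 2 →₀ ℕ) 1
        rw [pt_apply_one]; exact Nat.dvd_sub (h 1) hw
  by_cases hdvd : ∀ i, slotWeight d j ∣ P i
  · rw [vertexCoeff_of_dvd _ (hiff.mpr hdvd), vertexCoeff_of_dvd _ hdvd, pt_apply_zero, pt_apply_one]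
    show coeff _ (divTwo (d - (j : ℕ)) (A j)) = _
    have hle : d - (j : ℕ) ≤ P 1 / slotWeight d j := by
      have h1 := Nat.div_mul_cancel (hdvd 1)
      have hws := slotWeight_mul_sub j
      by_contra hlt
      push Not at hlt
      have : (P 1 / slotWeight d j + 1) * slotWeight d j ≤ (d - (j : ℕ)) * slotWeight d j := Nat.mul_le_mul_right _ hlt
      rw [Nat.add_mul, h1, one_mul, mul_comm (d - (j : ℕ)), hws] at this
      omega
    have hidx : (Finsupp.single 0 (P 0 / slotWeight d j) + Finsupp.single 1 ((P 1 - d.factorial) / slotWeight d j) : Fin 2 →₀ ℕ) =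
        Finsupp.single 0 ((Finsupp.single 0 (P 0 / slotWeight d j) + Finsupp.single 1 (P 1 / slotWeight d j) : Fin 2 →₀ ℕ) 0) +
          Finsupp.single 1 ((Finsupp.single 0 (P 0 / slotWeight d j) + Finsupp.single 1 (P 1 / slotWeight d j) : Fin 2 →₀ ℕ) 1 - (d - (j : ℕ))) := by
      rw [pt_apply_zero, pt_apply_one]
      congr 2
      apply Nat.eq_of_mul_eq_mul_right hwpos
      rw [Nat.div_mul_cancel (Nat.dvd_sub (hdvd 1) hw), Nat.sub_mul, Nat.div_mul_cancel (hdvd 1), mul_comm (d - (j : ℕ)),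
        slotWeight_mul_sub]
    rw [hidx, coeff_divTwo_shift _ _ _ (by rw [pt_apply_one]; exact hle)]
  · rw [vertexCoeff_of_not_dvd _ (fun h => hdvd (hiff.mp h)), vertexCoeff_of_not_dvd _ hdvd]

/-- SOLVABILITY IS CARRIED by `V(y,u₂)`. -/
theorem solvable_divTwoT_iff {d : ℕ} (A : Fin d → MvPowerSeries (Fin 2) k) {P : Fin 2 →₀ ℕ} (hP : d.factorial ≤ P 1) :
    Solvable d (divTwoT d A) (Finsupp.single 0 (P 0) + Finsupp.single 1 (P 1 - d.factorial)) ↔ Solvable d A P := by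
  unfold Solvable IsIntegral
  have hI : (∀ i, d.factorial ∣ (Finsupp.single 0 (P 0) + Finsupp.single 1 (P 1 - d.factorial) : Fin 2 →₀ ℕ) i) ↔ ∀ i, d.factorial ∣ P i := by
    constructor
    · intro h i
      have h0 := h 0; have h1 := h 1
      rw [pt_apply_zero] at h0; rw [pt_apply_one] at h1
      fin_cases i
      · exact h0
      · have : P 1 = (P 1 - d.factorial) + d.factorial := by omega
        show d.factorial ∣ P 1
        rw [this]; exact Nat.dvd_add h1 (dvd_refl _)
    · intro h i
      fin_cases i
      · show d.factorial ∣ (Finsupp.single 0 (P 0) + Finsupp.single 1 (P 1 - d.factorial) : Fin 2 →₀ ℕ) 0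
        rw [pt_apply_zero]; exact h 0
      · show d.factorial ∣ (Finsupp.single 0 (P 0) + Finsupp.single 1 (P 1 - d.factorial) : Fin 2 →₀ ℕ) 1
        rw [pt_apply_one]; exact Nat.dvd_sub (h 1) (dvd_refl _)
  rw [hI]
  simp only [vertexCoeff_divTwoT A hP]

/-- WELL-PREPAREDNESS PERSISTS under `V(y,u₂)` (CJS Lemma 12.4, second axis). -/
theorem wellPrepared_divTwoT {d : ℕ} (A : Fin d → MvPowerSeries (Fin 2) k) (hA : IsPermissibleTwoT d A) (hWP : WellPrepared d A) :
    WellPrepared d (divTwoT d A) := by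
  intro Q hQ
  have hQmem : Q ∈ newtonSet (divTwoT d A) := hQ.1
  rw [newtonSet_divTwoT A hA] at hQmem hQ
  obtain ⟨P, hP, rfl⟩ := hQmem
  have hv : IsVertex (newtonSet A) P := (isVertex_image_shift₂_iff (shiftTwoF_fst d A) (shiftTwoF_snd hA) hP).mp hQ
  have hP1 : d.factorial ≤ P 1 := by have := shiftTwoF_snd hA P hP; omega
  rw [solvable_divTwoT_iff A hP1]
  exact hWP P hv

end PolyDescent

end Summit.ResolutionOfSingularities.ResolutionOfSingularities.Theorems

end
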